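import Summits.QuantumFields.YangMills.Theorems.BalabanUVNodesN12Prop1OfGaugeLetterAndChartConstantsLoc
import Summits.QuantumFields.YangMills.Theorems.BalabanUVNodesN12GaugeLetterLocExplicitLocal

/-!
# BalabanUVNodes ∕ N12 — PROPOSITION 1 [IV] AT PRINT'S (1.74) OBJECT ON THE COERCIVE ROAD, CLASS ROAD («(viii)»): (iii) with the localised gauge letter (σ)_N DISCHARGED BY NAME from
# dag-n12-w3's explicit class-based producer IN ITS LOCAL EDITION `exists_gaugeLetterLoc_atRecord_explicit_local` (LOCATED-WJ repair: the member-shadow letter `hGmem` asked only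
# within walk-distance `ℓ_k + m′·L^k` of `Ω₁(Z)`) — fixed (guard-independent) tolerances `T i`, pinned; the chart constants and the localised
# chart body stay binders so that the numerics `hsm` at `T i` can be stated

Cell `pub-ymgap` (HUMAN RULINGS D-0062 ∕ D-0149 ∕ D-0154), WIDTH SEAT `pub-ymgap-dag-n12-w5` g5 (node N12 = [B15]; key K1⁹ `stmt-QuantumFields-27364`, `--kind proof --supports …
--as helper`; count-neutral).  dag-n12-w3 g4's OFFER (pub-ymgap INBOX 2026-08-28T17:12:51Z) accepted (17:14:05Z): the CLASS-road producer keys on the FIXED-tolerance socket (iii)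
(`…N12Prop1OfGaugeLetterAndChartConstantsLoc`, p637386), not on the ∀δ∃e road (iv)–(vii), because its tolerance does not shrink with the guard.  THEOREMS ONLY (0 `def`, 0 `instance`,
0 `sorry`); composition BY NAME of (iii) and `N12GaugeLetterLocExplicitLocal.exists_gaugeLetterLoc_atRecord_explicit_local` (p658487).  THIS FILE = dag-n12-w5 g5's (viii) p654901 (`…N12Prop1OfGaugeLetterExplicitLoc`) with ONE binder's premise weakened (`hGmem` local) and the producer call renamed — typed by dag-n12-d g19 on the lane owner's word «O1 GO» (dag-n12-w5 is ■; cell bus 2026-08-28T18:04Z), nothing else changed.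

WHAT CHANGES vs (iii).  GONE: `{δc δin} hδc0 hδin0 hσN`.  PINNED: `δc i = δin i := T i := max (ρn i) (((2ℓ_{k_i}+1+m·L^{k_i})²∕4)·(εreg·η₀²) + m·(6κ·Σ_{l<k_i} L^l) + m·ρn i)`
(`κ = (((d+2)L)²∕4)·(2εregL²)`, `m = 3·d·((L−1)∕2)+5`) — so `hsmall` becomes `hsmallT : T i ≤ ρs i` and `hsm` becomes `hsmT` (the same text at `T i`): explicit CONDITIONS on
`εreg`, `ρn i` and the chart constants (the closers' numerics; `B15Prop1NumericsThresholds` §3 names the threshold).  NEW (σ-side, displayed): per instance a level guard `c i` with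
`hkc hc`, the radius numerics `hMrad`, the geometry `hGN` (gN1, at the region box) `hN1` (gN2) `hGmem` (member shadows in the region box), and the uniform class numerics `hεpos hα3 hα2
haN hM₁`.  Everything else VERBATIM (iii) (incl. the chart constants + `hchartN` binders, `hγle`, bookkeeping, `h15T`).

HONEST FRAMING.  Composition by name + sign bookkeeping; nothing of Bałaban's is asserted; (J0′), the chart body, the [15] Theorem-1 letter, the numerics and the geometry stay
DISPLAYED; SCALING CAVEAT travels with the socket (dag-n12-c g20 ∕ dag-n12-w3 g4, INBOX 2026-08-28T15:50Z: the scale-0 class tolerance `∼ L^{2k}·εreg` is crude — `hsmT` is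
satisfiable only for `εreg` far below the instance thresholds); bondwise road = simply-connected normalisable `Ω₁(Z_i)` (LOCATED-GEOM v3); count-neutral; N12 NOT discharged; K1⁹ NOT
closed; counts unmoved; one finite 𝕋⁴ programme at fixed `ε = L^{-K}` — R4 closes only the conditional rung `BalabanLadder.UV`; no summit statement is proved here and NOT the
Yang–Mills mass gap (Clay); nothing continuum ∕ ℝ⁴ ∕ OS.

References: [Balaban1989LargeFieldI] CMP 122 (1989) 175–202, (1.74) p.192, Prop. 1 (1.77)–(1.78) p.194; [Balaban1989LargeFieldII] CMP 122 (1989) 355–392, p.357, (1.7)–(1.9) p.358,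
(1.12)–(1.13) p.359; [Balaban1985Variational] CMP 102 (1985) 277–309, (3)–(4) p.278, Thm 1 (8) p.279, (16)–(18) p.280, Prop. 9 (190) p.309; [Balaban1985Averaging] CMP 98 (1985) 17–51,
Prop. 2; [Balaban1988Convergent] CMP 119 (1988) 243–285, (2.2) p.255, (2.11)–(2.14) pp.256–257.
-/

noncomputable section

open Set Finset Metric Filter
open scoped BigOperators Matrix RealInnerProductSpace Real InnerProductSpace Topology Matrix.Norms.L2Operator

namespace Summit.QuantumFields.YangMills.BalabanUVNodes.N12Prop1OfGaugeLetterExplicitLocLocal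

open Literature.MathematicalPhysics.QuantumFieldTheory.Balaban1983to89
open T4Continuum B15DeterminingSets GaugeField B16Sect1Backgrounds B15Prop1Carrier B8Eq17ClassAkV1 BlockAveraging
open B15Prop1SliceTaylorCalculus
open B15Prop1ChartCalculusSU2 (E3)
open T4CubeChartGnomonic (SU2)
open B15Prop1ChartSU2 (su2Chart)
open B15Prop1SliceCoordinates (GaugeSlice ιA freeBonds)
open B15Prop1AnalyticExtClause (cplxVec anExt)
open T4AdjointCovarianceUnitary (lieSU)
open T4AxialGaugeSmallField (castSite boxPlaqs boxBonds)
open B6BondElimination (unitVec)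
open B6TreeGaugePoincare (curl)
open B16Eq18Proof (box mem_box)
open B15Extension193 (extend)
open B15ShellGauge193 (shellGauge)
open B14.Eq213MaximalDomains (side)
open B14.Eq213DetSet B14.Eq216Concrete B15Sect1Instances B15Eq177GaugeInvariance B15Eq177ValueInvariance B15Eq177ValueInvarianceCoDiv B16Sect1Wilson
open B14.Eq22Determines (blockIter IsBlockUnion)
open Literature.MathematicalPhysics.QuantumFieldTheory.BalabanImbrieJaffe1984to88.BIJ85Eq453GaugeField
open Node00 (expChart msChart constrCard)
open B5Eq118OneStroke (iterBlockOf)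
open ExpMeanLog (deltaSU)

variable {F : T4Family}
set_option maxHeartbeats 400000 in
/-- ★★★ **PROPOSITION 1 [IV] AT PRINT'S (1.74) OBJECT — COERCIVE ROAD — (iii) WITH THE LOCALISED GAUGE LETTER DISCHARGED BY dag-n12-w3's EXPLICIT CLASS-ROAD PRODUCER, TOLERANCES
PINNED TO `T i`.**  See the module docstring for the binder delta.  Proof: (iii) at `δc = δin := T`, `hσN := exists_gaugeLetterLoc_atRecord_explicit …` per instance, `max_self` bridges.
[cite: Balaban1989LargeFieldI, (1.74) p.192, Prop. 1 (1.77)–(1.78) p.194 (incl. the last clause), (1.79) p.195; Balaban1989LargeFieldII, p.357, (1.7)–(1.9) p.358, (1.12)–(1.13) p.359;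
Balaban1985Variational, (3)–(4) p.278, Thm 1 (8) p.279, (16)–(18) p.280, Prop. 9 (190) p.309; Balaban1988Convergent, (2.2) p.255, (2.12)–(2.14) pp.256–257] -/
theorem exists_domain_prop1Printed_lfVarOn_std_su2_box_intrinsic_analytic_atZSeqCoPRecord_ofThm1TorusClass_ofMinimiserFamily_ofGaugeLetterExplicitLocal_ofChartConstantsN_ofCoercive
    (ν : Node00.Stage7Numerics) (Kt : ℕ) (hd3 : 3 ≤ (F.P Kt).d) (h0 : 0 < (F.P Kt).d) {ι : Type}
    (Z Λ : ι → Set (Site (F.P Kt) 0)) (k : ι → ℕ) (M : ι → ℝ) (hk0 : ∀ i, 0 < k i) (hk : ∀ i, k i ≤ (F.P Kt).m + (F.P Kt).K)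
    (eR : ι → ℝ) (heR : ∀ i, 0 < eR i)
    (T : ∀ i, Finset (PBond (F.P Kt) (k i)))
    (lo hi : ι → Fin (F.P Kt).d → ℤ) (n : ι → ℕ) (hn : ∀ i κ, hi i κ ≤ lo i κ + n i) (hN : ∀ i, n i + 2 < (F.P Kt).sitesPerDir (k i))
    (hbox : ∀ i, pts (k i) (Λ i) = (castSite '' Set.Icc (lo i) (hi i) : Set (Site (F.P Kt) (k i))))
    (hZ : ∀ i, (boxPlaqs (lo i - 1) (hi i + 1) : Set (Plaq (F.P Kt) (k i))) ⊆ plaqsInside (pts (k i) (Z i)))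
    (hTG0 : ∀ i, T i = (box (fun κ => (hi i κ - lo i κ + 1).toNat) (lo i)).image fun x =>
      (⟨castSite (x - unitVec ⟨0, h0⟩), ⟨0, h0⟩⟩ : PBond (F.P Kt) (k i)))
    (hN5 : ∀ i κ, ((hi i κ - lo i κ + 1).toNat : ℤ) + 5 < (F.P Kt).sitesPerDir (k i))
    (K : ι → ℕ) (hK1 : ∀ i, 1 ≤ K i) (hKn : ∀ i κ, (hi i κ - lo i κ + 1).toNat ≤ K i)
    (ext : ∀ i, GaugeField (F.P Kt) (k i) SU2 → GaugeField (F.P Kt) (k i) SU2)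
    (hext : ∀ i Vk, ext i Vk = extend (pts (k i) (Λ i)) (shellGauge Vk (lo i) (hi i)) Vk)
    (hlohi : ∀ i, lo i ≤ hi i)
    -- the REGION parallelepipeds of the normalisation and the datum tolerances
    (LO HI : ι → Fin (F.P Kt).d → ℤ) (hLO : ∀ i, LO i ≤ lo i - 1) (hHI : ∀ i, hi i + 1 ≤ HI i) (n' : ι → ℕ) (hn' : ∀ i κ, HI i κ ≤ LO i κ + n' i)
    (hn'N : ∀ i, n' i < (F.P Kt).sitesPerDir (k i)) (hR' : ∀ i, (boxPlaqs (LO i) (HI i) : Set (Plaq (F.P Kt) (k i))) ⊆ plaqsInside (pts (k i) (Z i)))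
    (ρn : ι → ℝ)
    (hρn : ∀ i, (((F.P Kt).d : ℝ) * n' i + 1) * ((((F.P Kt).d - 1 : ℕ) : ℝ) * n' i * ((12 * (F.P Kt).d * (n i + 2) ^ 2 + 1) * eR i)
      + 3 * (F.P Kt).d * (n i + 2) ^ 2 * eR i) ≤ ρn i)
    {γ cJ bx : ℝ} (hγ : 0 < γ) (hcJ : 0 ≤ cJ) (hbx : 0 ≤ bx)
    (hbxM : ∀ i, 12 * ((F.P Kt).d : ℝ) * ((n i : ℝ) + 2) ^ 2 ≤ bx * (M i) ^ 2)
    {R 𝓐₀ : ι → ℝ} (hM : ∀ i, 1 ≤ (M i)) (hR : ∀ i, 0 < R i)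
    -- (J0′), R-EXPLICIT: per instance one radius and one bound for every base field of the strict guard
    (hMin : ∀ i Vk, PlaqSmallOn (plaqsInside (pts (k i) (Z i ∩ (Λ i)ᶜ))) (eR i) Vk →
      ∃ Ũ : VecField (F.P Kt) (k i) (EuclideanSpace ℂ (Fin 3)) × VecField (F.P Kt) (k i) (EuclideanSpace ℂ (Fin 3)) →
          PBond (F.P Kt) 0 → Matrix (Fin 2) (Fin 2) ℂ,
        (∀ b a c, DifferentiableOn ℂ (fun z => Ũ z b a c) (ball 0 (R i))) ∧
        (∀ z ∈ ball (0 : VecField (F.P Kt) (k i) (EuclideanSpace ℂ (Fin 3)) × VecField (F.P Kt) (k i) (EuclideanSpace ℂ (Fin 3))) (R i),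
          ∀ b a c, ‖Ũ z b a c‖ ≤ 𝓐₀ i) ∧
        ∀ p B' : VecField (F.P Kt) (k i) E3, ‖p‖ < R i → ‖B'‖ < R i → ∃ U' : GaugeField (F.P Kt) 0 SU2,
          (∀ b, Ũ (cplxVec p, cplxVec B') b = ((U' b : SU2) : Matrix (Fin 2) (Fin 2) ℂ)) ∧
            IsMinimizer (Node00.avOfRecord F 2 Kt) (Node00.regMSCoPOfRecord F 2 ν Kt (k i) (maxDomT ν.M₁ (Z i))) (Bj ν.M₁ (Z i) (k i))
              (avgFamily (Node00.avOfRecord F 2 Kt) (qsstarGIter0 (k i) (expMul su2Chart B' (ext i (expMul su2Chart p Vk))))) U')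
    -- the CHART CONSTANTS of dag-n12-w4's `chartLetter_of_letters_N` (binders, so that `hsm` can be stated); the tolerances are PINNED to the explicit producer's `T i` (docstring)
    (ρs Cμ Cρ C₂ Cτ : ι → ℝ) (hCμ : ∀ i, 0 ≤ Cμ i) (hCρ : ∀ i, 0 ≤ Cρ i) (hC₂ : ∀ i, 0 ≤ C₂ i)
    (hsmallT : ∀ i, max (ρn i) ((((2 * (∑ l ∈ Finset.range (k i + 1), ((F.P Kt).d * (((F.P Kt).L ^ l - 1) / 2) + 1)) + 1 + (3 * ((F.P Kt).d * (((F.P Kt).L - 1) / 2)) + 5) * (F.P Kt).L ^ (k i) : ℕ) : ℝ)) ^ 2 / 4 * (ν.εreg * (F.P Kt).eta 0 ^ 2) + ((3 * ((F.P Kt).d * (((F.P Kt).L - 1) / 2)) + 5 : ℕ) : ℝ) * (6 * ((((((F.P Kt).d + 2) * (F.P Kt).L : ℕ) : ℝ) ^ 2 / 4) * (2 * (ν.εreg * (F.P Kt).L ^ 2))) * ∑ l ∈ Finset.range (k i), ((F.P Kt).L : ℝ) ^ l) + ((3 * ((F.P Kt).d * (((F.P Kt).L - 1) / 2)) + 5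 : ℕ) : ℝ) * ρn i) ≤ ρs i) (h𝓐₀ : ∀ i, 0 ≤ 𝓐₀ i)
    -- LOCATED-CIN (R-a): per instance the bond neighbourhood on which the `inputs` near-flatness is delivered ∕ asked
    (N : ι → Set (PBond (F.P Kt) 0))
    -- (σ)_N DISCHARGED BY NAME from dag-n12-w3 g4's `N12GaugeLetterLocExplicit.exists_gaugeLetterLoc_atRecord_explicit` (CLASS road, fixed tolerance): its displayed inputs —
    -- NUMERICS (level guard ∕ no wrapping ∕ radii ∕ the class threshold `εreg`) and GEOMETRY ((gN1) `hGN` at the region box, (gN2) `hN1`, the member-shadow letter `hGmem`)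
    (c : ι → ℕ) (hkc : ∀ i, k i + c i ≤ (F.P Kt).m + (F.P Kt).K) (hc : ∀ i, 4 * (F.P Kt).d + (3 * ((F.P Kt).d * (((F.P Kt).L - 1) / 2)) + 5) + 3 < 2 * (F.P Kt).L ^ (c i))
    (hMrad : (4 * (F.P Kt).d + (3 * ((F.P Kt).d * (((F.P Kt).L - 1) / 2)) + 5)) * (F.P Kt).L ^ 2 + 2 * (F.P Kt).d * (F.P Kt).L + 12 ≤ ν.M₁)
    (hGN : ∀ i, ∀ b ∈ N i, (b.src ∉ maxDomT ν.M₁ (Z i) 1 ∨ b.tgt ∉ maxDomT ν.M₁ (Z i) 1) → blockIter (k i) b.tgt ≠ blockIter (k i) b.src →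
      (⟨blockIter (k i) b.src, b.dir⟩ : PBond (F.P Kt) (k i)) ∈ (boxBonds (LO i) (HI i) : Set (PBond (F.P Kt) (k i))))
    (hN1 : ∀ i, ∀ p : Plaq (F.P Kt) 0, ((⟨p.src, p.μ⟩ : PBond (F.P Kt) 0) ∈ {b : PBond (F.P Kt) 0 | b.src ∈ maxDomT ν.M₁ (Z i) 1} ∨
        (⟨p.src.shift p.μ, p.ν⟩ : PBond (F.P Kt) 0) ∈ {b : PBond (F.P Kt) 0 | b.src ∈ maxDomT ν.M₁ (Z i) 1} ∨
        (⟨p.src.shift p.ν, p.μ⟩ : PBond (F.P Kt) 0) ∈ {b : PBond (F.P Kt) 0 | b.src ∈ maxDomT ν.M₁ (Z i) 1} ∨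
        (⟨p.src, p.ν⟩ : PBond (F.P Kt) 0) ∈ {b : PBond (F.P Kt) 0 | b.src ∈ maxDomT ν.M₁ (Z i) 1}) →
      (⟨p.src, p.μ⟩ : PBond (F.P Kt) 0) ∈ N i ∧ (⟨p.src.shift p.μ, p.ν⟩ : PBond (F.P Kt) 0) ∈ N i ∧
        (⟨p.src.shift p.ν, p.μ⟩ : PBond (F.P Kt) 0) ∈ N i ∧ (⟨p.src, p.ν⟩ : PBond (F.P Kt) 0) ∈ N i)
    (hεpos : 0 < ν.εreg)
    (hα3 : (143 * (((((F.P Kt).d + 4 : ℕ) : ℝ)) ^ 2 / 4) ^ 2) * (ν.εreg * (F.P Kt).L ^ 2) ≤ 1 / 3)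
    (hα2 : 2 * (ν.εreg * (F.P Kt).L ^ 2) ≤ 2 * deltaSU (Fin 2) / ((((F.P Kt).d + 4) * (F.P Kt).L : ℕ) : ℝ) ^ 2)
    (haN : (((((F.P Kt).d + 2) * (F.P Kt).L : ℕ) : ℝ) ^ 2 / 4) * (2 * (ν.εreg * (F.P Kt).L ^ 2)) < deltaSU (Fin 2))
    (hM₁ : (((F.P Kt).d + 4) * (F.P Kt).L + 6) * (F.P Kt).L ^ 2 ≤ ν.M₁)
    -- LOCATED-WJ (lane ruling 2026-08-28T17:49Z): the member-shadow letter asked ONLY for members within walk-distance `ℓ_{k} + m′·L^{k}` of `Ω₁(Z_i)` (dag-n12-w3's LOCAL producer)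
    (hGmem : ∀ i, ∀ x ∈ maxDomT ν.M₁ (Z i) 1, ∀ lv ≤ k i, ∀ c' ∈ bondsOf ((Bj ν.M₁ (Z i) (k i) : DetSet (F.P Kt)) lv),
      (∃ w : List (Letter (F.P Kt).d), w.length ≤ (∑ l ∈ Finset.range (k i + 1), ((F.P Kt).d * (((F.P Kt).L ^ l - 1) / 2) + 1)) + (3 * ((F.P Kt).d * (((F.P Kt).L - 1) / 2)) + 5) * (F.P Kt).L ^ (k i) ∧
        (walkEnd x w = embIter lv c'.src ∨ walkEnd x w = embIter lv c'.tgt)) →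
      blockIter (k i) (embIter lv c'.tgt) ≠ blockIter (k i) (embIter lv c'.src) → (⟨blockIter (k i) (embIter lv c'.src), c'.dir⟩ : PBond (F.P Kt) (k i)) ∈ (boxBonds (LO i) (HI i) : Set (PBond (F.P Kt) (k i))))
    -- (χ)_N AT THE CHART CONSTANTS: the body of dag-n12-w4's `chartLetter_of_letters` after its `∃ ρs Cμ Cρ C₂ Cτ`, per instance, with its `inputs` PREMISE LOCALISED to
    -- `N i` — a BINDER until `chartLetter_of_letters_N` lands (then supplied by name + `choose`, as in p631882 §1)
    (hchartN : ∀ i,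
      ∀ (ext' : GaugeField (F.P Kt) (k i) SU2 → GaugeField (F.P Kt) (k i) SU2) (Vk : GaugeField (F.P Kt) (k i) SU2) {R' A' : ℝ}, 0 < R' → 0 ≤ A' →
      ∀ {δ' δi' : ℝ}, 0 ≤ δ' → 0 ≤ δi' → 0 < max δ' δi' → max δ' δi' ≤ ρs i →
      ∀ (U₀ : GaugeField (F.P Kt) 0 SU2) (Xf : GaugeSlice (pts (k i) (Λ i)) (T i) E3 → PBond (F.P Kt) 0 → lieSU (Fin 2)),
      IsMinimizer (Node00.avOfRecord F 2 Kt) (Node00.regMSCoPOfRecord F 2 ν Kt (k i) (maxDomT ν.M₁ (Z i))) (Bj ν.M₁ (Z i) (k i))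
        (avgFamily (Node00.avOfRecord F 2 Kt) (qsstarGIter0 (k i) (ext' Vk))) U₀ →
      (∀ p : Plaq (F.P Kt) 0, ((⟨p.src, p.μ⟩ : PBond (F.P Kt) 0) ∈ {b : PBond (F.P Kt) 0 | b.src ∈ maxDomT ν.M₁ (Z i) 1} ∨
          (⟨p.src.shift p.μ, p.ν⟩ : PBond (F.P Kt) 0) ∈ {b : PBond (F.P Kt) 0 | b.src ∈ maxDomT ν.M₁ (Z i) 1} ∨
          (⟨p.src.shift p.ν, p.μ⟩ : PBond (F.P Kt) 0) ∈ {b : PBond (F.P Kt) 0 | b.src ∈ maxDomT ν.M₁ (Z i) 1} ∨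
          (⟨p.src, p.ν⟩ : PBond (F.P Kt) 0) ∈ {b : PBond (F.P Kt) 0 | b.src ∈ maxDomT ν.M₁ (Z i) 1}) →
        ‖((U₀ ⟨p.src, p.μ⟩ : SU2) : Matrix (Fin 2) (Fin 2) ℂ) - 1‖ ≤ δ' ∧ ‖((U₀ ⟨p.src.shift p.μ, p.ν⟩ : SU2) : Matrix (Fin 2) (Fin 2) ℂ) - 1‖ ≤ δ' ∧
          ‖((U₀ ⟨p.src.shift p.ν, p.μ⟩ : SU2) : Matrix (Fin 2) (Fin 2) ℂ) - 1‖ ≤ δ' ∧ ‖((U₀ ⟨p.src, p.ν⟩ : SU2) : Matrix (Fin 2) (Fin 2) ℂ) - 1‖ ≤ δ') →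
      (∀ b ∈ inputs (Bj ν.M₁ (Z i) (k i)), b ∈ N i → ‖((U₀ b : SU2) : Matrix (Fin 2) (Fin 2) ℂ) - 1‖ ≤ δi') →
      Xf 0 = 0 → ContDiffAt ℝ 2 Xf 0 →
      (∀ᶠ Y in 𝓝 (0 : GaugeSlice (pts (k i) (Λ i)) (T i) E3),
        IsMinimizer (Node00.avOfRecord F 2 Kt) (Node00.regMSCoPOfRecord F 2 ν Kt (k i) (maxDomT ν.M₁ (Z i))) (Bj ν.M₁ (Z i) (k i))
          (avgFamily (Node00.avOfRecord F 2 Kt) (qsstarGIter0 (k i) (expMul su2Chart (ιA (pts (k i) (Λ i)) (T i) Y) (ext' Vk)))) (expChart U₀ (Xf Y))) →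
      (∀ (X : GaugeSlice (pts (k i) (Λ i)) (T i) E3) (b : PBond (F.P Kt) 0),
        ‖((fderiv ℝ Xf 0 X b : lieSU (Fin 2)) : Matrix (Fin 2) (Fin 2) ℂ)‖ ≤ 8 * A' / R' * ‖X‖ ∧ ‖fderiv ℝ Xf 0 X b‖ ≤ 12 * A' / R' * ‖X‖) →
      (∀ (X : GaugeSlice (pts (k i) (Λ i)) (T i) E3) (b : PBond (F.P Kt) 0), b.src ∉ maxDomT ν.M₁ (Z i) 1 → fderiv ℝ Xf 0 X b = 0) →
      ∃ (Ψ₂ : (PBond (F.P Kt) 0 → lieSU (Fin 2)) →L[ℝ] (PBond (F.P Kt) 0 → lieSU (Fin 2)) →L[ℝ] (Fin (constrCard (Bj ν.M₁ (Z i) (k i)) (k i)) → lieSU (Fin 2)))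
        (lam : (Fin (constrCard (Bj ν.M₁ (Z i) (k i)) (k i)) → lieSU (Fin 2)) →L[ℝ] ℝ)
        (p : Seminorm ℝ (PBond (F.P Kt) 0 → lieSU (Fin 2))) (q : (Fin (constrCard (Bj ν.M₁ (Z i) (k i)) (k i)) → lieSU (Fin 2)) → ℝ)
        (Lf : (PBond (F.P Kt) 0 → lieSU (Fin 2)) →L[ℝ] (Fin (constrCard (Bj ν.M₁ (Z i) (k i)) (k i)) → lieSU (Fin 2)))
        (Rf : (Fin (constrCard (Bj ν.M₁ (Z i) (k i)) (k i)) → lieSU (Fin 2)) → PBond (F.P Kt) 0 → lieSU (Fin 2)),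
        HasFDerivAt (fun Y => fderiv ℝ (msChart F 2 Kt (k i) (Bj ν.M₁ (Z i) (k i)) (avgFamily (Node00.avOfRecord F 2 Kt) (qsstarGIter0 (k i) (ext' Vk))) U₀) Y) Ψ₂ 0 ∧
        (∀ᶠ Y in 𝓝 (0 : PBond (F.P Kt) 0 → lieSU (Fin 2)),
          DifferentiableAt ℝ (msChart F 2 Kt (k i) (Bj ν.M₁ (Z i) (k i)) (avgFamily (Node00.avOfRecord F 2 Kt) (qsstarGIter0 (k i) (ext' Vk))) U₀) Y) ∧
        fderiv ℝ (fun Y : PBond (F.P Kt) 0 → lieSU (Fin 2) => wilsonAction4 (expChart U₀ Y)) 0 =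
          lam.comp (fderiv ℝ (msChart F 2 Kt (k i) (Bj ν.M₁ (Z i) (k i)) (avgFamily (Node00.avOfRecord F 2 Kt) (qsstarGIter0 (k i) (ext' Vk))) U₀) 0) ∧
        (∀ Y : PBond (F.P Kt) 0 → lieSU (Fin 2), ∑ b, ‖(Y b : Matrix (Fin 2) (Fin 2) ℂ)‖ ^ 2 ≤ p Y ^ 2) ∧
        (∀ v, Lf (Rf v) = v) ∧ (∀ v, p (Rf v) ≤ Cρ i * q v) ∧
        ∀ X : GaugeSlice (pts (k i) (Λ i)) (T i) E3,
          q (fderiv ℝ (msChart F 2 Kt (k i) (Bj ν.M₁ (Z i) (k i)) (avgFamily (Node00.avOfRecord F 2 Kt) (qsstarGIter0 (k i) (ext' Vk))) U₀) 0 (fderiv ℝ Xf 0 X)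
              - Lf (fderiv ℝ Xf 0 X)) ≤ (C₂ i * max δ' δi') * p (fderiv ℝ Xf 0 X) ∧
          lam (Ψ₂ (fderiv ℝ Xf 0 X) (fderiv ℝ Xf 0 X)) ≤ (Cμ i * max δ' δi') * p (fderiv ℝ Xf 0 X) ^ 2 ∧
          p (fderiv ℝ Xf 0 X) ≤ (12 * A' / R' * Real.sqrt (Nat.card {b : PBond (F.P Kt) 0 // b.src ∈ maxDomT ν.M₁ (Z i) 1})) * ‖X‖ ∧
          ∃ m : ℝ, (∀ w', Lf w' = fderiv ℝ (msChart F 2 Kt (k i) (Bj ν.M₁ (Z i) (k i)) (avgFamily (Node00.avOfRecord F 2 Kt) (qsstarGIter0 (k i) (ext' Vk))) U₀) 0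
                (fderiv ℝ Xf 0 X) →
              m ≤ fderiv ℝ (fun Y => fderiv ℝ (fun Y : PBond (F.P Kt) 0 → lieSU (Fin 2) => wilsonAction4 (expChart (1 : GaugeField (F.P Kt) 0 SU2) Y)) Y) 0 w' w') ∧
            (((F.P Kt).L : ℝ) ^ (F.P Kt).d) ^ (k i) / ((((F.P Kt).L : ℝ)) ^ 2 * ((F.P Kt).L : ℝ) ^ 2) ^ (k i) *
                (∑ z ∈ box (fun κ => (hi i κ - lo i κ + 1).toNat + 3) (fun κ => lo i κ - 2), ∑ μ : Fin (F.P Kt).d, ∑ a : Fin 3,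
                  curl (fun b => ιA (pts (k i) (Λ i)) (T i) X (⟨castSite b.1, b.2⟩ : PBond (F.P Kt) (k i)) a) z ⟨0, h0⟩ μ ^ 2)
              - ((((F.P Kt).L : ℝ) ^ (F.P Kt).d) ^ (k i) / ((((F.P Kt).L : ℝ)) ^ 2 * ((F.P Kt).L : ℝ) ^ 2) ^ (k i)
                  * (16 * (((F.P Kt).d : ℝ) + 1) * (Cτ i * max δ' δi'))) * ‖X‖ ^ 2 ≤ m)
    -- numerics IN THE CHART CONSTANTS AT THE PINNED TOLERANCE `T i` (`γ₀ := 1`: dag-n12-w4's per-instance `γ₀(k) = (L^d)^k∕(L²·L²)^k` is `1` at `d = 4`): the assembled `Cerr i` is small, the positivity constant fits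
    (hsmT : ∀ i, (32 * (((F.P Kt).d : ℝ) - 1) * (max (ρn i) ((((2 * (∑ l ∈ Finset.range (k i + 1), ((F.P Kt).d * (((F.P Kt).L ^ l - 1) / 2) + 1)) + 1 + (3 * ((F.P Kt).d * (((F.P Kt).L - 1) / 2)) + 5) * (F.P Kt).L ^ (k i) : ℕ) : ℝ)) ^ 2 / 4 * (ν.εreg * (F.P Kt).eta 0 ^ 2) + ((3 * ((F.P Kt).d * (((F.P Kt).L - 1) / 2)) + 5 : ℕ) : ℝ) * (6 * ((((((F.P Kt).d + 2) * (F.P Kt).L : ℕ) : ℝ) ^ 2 / 4) * (2 * (ν.εreg * (F.P Kt).L ^ 2))) * ∑ l ∈ Finset.range (k i), ((F.P Kt).L : ℝ) ^ l) + ((3 * ((F.P Kt).d * (((F.P Kt).L - 1) / 2)) + 5 : ℕ) : ℝ) * ρn i)) + Cμ i * max ((max (ρn i) ((((2 * (∑ l ∈ Finset.range (k i + 1), ((F.P Kt).d * (((F.P Kt).L ^ l - 1) / 2) + 1)) + 1 + (3 * ((F.P Kt).d * (((F.P Kt).L - 1) / 2)) + 5) * (F.P Kt).L ^ (k i) : ℕ)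 : ℝ)) ^ 2 / 4 * (ν.εreg * (F.P Kt).eta 0 ^ 2) + ((3 * ((F.P Kt).d * (((F.P Kt).L - 1) / 2)) + 5 : ℕ) : ℝ) * (6 * ((((((F.P Kt).d + 2) * (F.P Kt).L : ℕ) : ℝ) ^ 2 / 4) * (2 * (ν.εreg * (F.P Kt).L ^ 2))) * ∑ l ∈ Finset.range (k i), ((F.P Kt).L : ℝ) ^ l) + ((3 * ((F.P Kt).d * (((F.P Kt).L - 1) / 2)) + 5 : ℕ) : ℝ) * ρn i))) ((max (ρn i) ((((2 * (∑ l ∈ Finset.range (k i + 1), ((F.P Kt).d * (((F.P Kt).L ^ l - 1) / 2) + 1)) + 1 + (3 * ((F.P Kt).d * (((F.P Kt).L - 1) / 2)) + 5) * (F.P Kt).L ^ (k i) : ℕ) : ℝ)) ^ 2 / 4 * (ν.εreg * (F.P Kt).eta 0 ^ 2) + ((3 * ((F.P Kt).d * (((F.P Kt).L - 1) / 2)) + 5 : ℕ) : ℝ) * (6 * ((((((F.P Kt).d + 2) * (F.P Kt).L : ℕ) : ℝ) ^ 2 / 4) * (2 * (ν.εreg * (F.P Kt).L ^ 2))) * ∑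 l ∈ Finset.range (k i), ((F.P Kt).L : ℝ) ^ l) + ((3 * ((F.P Kt).d * (((F.P Kt).L - 1) / 2)) + 5 : ℕ) : ℝ) * ρn i)))
        + 16 * (((F.P Kt).d : ℝ) - 1) * (Cρ i * (C₂ i * max ((max (ρn i) ((((2 * (∑ l ∈ Finset.range (k i + 1), ((F.P Kt).d * (((F.P Kt).L ^ l - 1) / 2) + 1)) + 1 + (3 * ((F.P Kt).d * (((F.P Kt).L - 1) / 2)) + 5) * (F.P Kt).L ^ (k i) : ℕ) : ℝ)) ^ 2 / 4 * (ν.εreg * (F.P Kt).eta 0 ^ 2) + ((3 * ((F.P Kt).d * (((F.P Kt).L - 1) / 2)) + 5 : ℕ) : ℝ) * (6 * ((((((F.P Kt).d + 2) * (F.P Kt).L : ℕ) : ℝ) ^ 2 / 4) * (2 * (ν.εreg * (F.P Kt).L ^ 2))) * ∑ l ∈ Finset.range (k i), ((F.P Kt).L : ℝ) ^ l) + ((3 * ((F.P Kt).d * (((F.P Kt).L - 1) / 2)) + 5 : ℕ) : ℝ) * ρn i))) ((max (ρn i) ((((2 * (∑ l ∈ Finset.range (k i + 1), ((F.P Kt).d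 * (((F.P Kt).L ^ l - 1) / 2) + 1)) + 1 + (3 * ((F.P Kt).d * (((F.P Kt).L - 1) / 2)) + 5) * (F.P Kt).L ^ (k i) : ℕ) : ℝ)) ^ 2 / 4 * (ν.εreg * (F.P Kt).eta 0 ^ 2) + ((3 * ((F.P Kt).d * (((F.P Kt).L - 1) / 2)) + 5 : ℕ) : ℝ) * (6 * ((((((F.P Kt).d + 2) * (F.P Kt).L : ℕ) : ℝ) ^ 2 / 4) * (2 * (ν.εreg * (F.P Kt).L ^ 2))) * ∑ l ∈ Finset.range (k i), ((F.P Kt).L : ℝ) ^ l) + ((3 * ((F.P Kt).d * (((F.P Kt).L - 1) / 2)) + 5 : ℕ) : ℝ) * ρn i))))) * (2 + Cρ i * (C₂ i * max ((max (ρn i) ((((2 * (∑ l ∈ Finset.range (k i + 1), ((F.P Kt).d * (((F.P Kt).L ^ l - 1) / 2) + 1)) + 1 + (3 * ((F.P Kt).d * (((F.P Kt).L - 1) / 2)) + 5) * (F.P Kt).L ^ (k i) : ℕ) : ℝ)) ^ 2 / 4 * (ν.εreg * (F.P Kt).eta 0 ^ 2) + ((3 * ((F.P Kt).d * (((F.P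 Kt).L - 1) / 2)) + 5 : ℕ) : ℝ) * (6 * ((((((F.P Kt).d + 2) * (F.P Kt).L : ℕ) : ℝ) ^ 2 / 4) * (2 * (ν.εreg * (F.P Kt).L ^ 2))) * ∑ l ∈ Finset.range (k i), ((F.P Kt).L : ℝ) ^ l) + ((3 * ((F.P Kt).d * (((F.P Kt).L - 1) / 2)) + 5 : ℕ) : ℝ) * ρn i))) ((max (ρn i) ((((2 * (∑ l ∈ Finset.range (k i + 1), ((F.P Kt).d * (((F.P Kt).L ^ l - 1) / 2) + 1)) + 1 + (3 * ((F.P Kt).d * (((F.P Kt).L - 1) / 2)) + 5) * (F.P Kt).L ^ (k i) : ℕ) : ℝ)) ^ 2 / 4 * (ν.εreg * (F.P Kt).eta 0 ^ 2) + ((3 * ((F.P Kt).d * (((F.P Kt).L - 1) / 2)) + 5 : ℕ) : ℝ) * (6 * ((((((F.P Kt).d + 2) * (F.P Kt).L : ℕ) : ℝ) ^ 2 / 4) * (2 * (ν.εreg * (F.P Kt).L ^ 2))) * ∑ l ∈ Finset.range (k i), ((F.P Kt).L : ℝ) ^ l) + ((3 * ((F.P Kt).d * (((F.P Kt).L - 1)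 / 2)) + 5 : ℕ) : ℝ) * ρn i))))))
        * (12 * 𝓐₀ i / R i * Real.sqrt (Nat.card {b : PBond (F.P Kt) 0 // b.src ∈ maxDomT ν.M₁ (Z i) 1})) ^ 2
        + 16 * (((F.P Kt).d : ℝ) + 1) * (Cτ i * max ((max (ρn i) ((((2 * (∑ l ∈ Finset.range (k i + 1), ((F.P Kt).d * (((F.P Kt).L ^ l - 1) / 2) + 1)) + 1 + (3 * ((F.P Kt).d * (((F.P Kt).L - 1) / 2)) + 5) * (F.P Kt).L ^ (k i) : ℕ) : ℝ)) ^ 2 / 4 * (ν.εreg * (F.P Kt).eta 0 ^ 2) + ((3 * ((F.P Kt).d * (((F.P Kt).L - 1) / 2)) + 5 : ℕ) : ℝ) * (6 * ((((((F.P Kt).d + 2) * (F.P Kt).L : ℕ) : ℝ) ^ 2 / 4) * (2 * (ν.εreg * (F.P Kt).L ^ 2))) * ∑ l ∈ Finset.range (k i), ((F.P Kt).L : ℝ) ^ l) + ((3 * ((F.P Kt).d * (((F.P Kt).L - 1) / 2)) + 5 : ℕ) : ℝ) * ρn i))) ((max (ρn i) ((((2 * (∑ l ∈ Finset.range (k i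 + 1), ((F.P Kt).d * (((F.P Kt).L ^ l - 1) / 2) + 1)) + 1 + (3 * ((F.P Kt).d * (((F.P Kt).L - 1) / 2)) + 5) * (F.P Kt).L ^ (k i) : ℕ) : ℝ)) ^ 2 / 4 * (ν.εreg * (F.P Kt).eta 0 ^ 2) + ((3 * ((F.P Kt).d * (((F.P Kt).L - 1) / 2)) + 5 : ℕ) : ℝ) * (6 * ((((((F.P Kt).d + 2) * (F.P Kt).L : ℕ) : ℝ) ^ 2 / 4) * (2 * (ν.εreg * (F.P Kt).L ^ 2))) * ∑ l ∈ Finset.range (k i), ((F.P Kt).L : ℝ) ^ l) + ((3 * ((F.P Kt).d * (((F.P Kt).L - 1) / 2)) + 5 : ℕ) : ℝ) * ρn i))))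
      ≤ 1 / (2 * (3 * (K i : ℝ) ^ 2 + 2 * (K i : ℝ) ^ 4)))
    (hγle : ∀ i, γ / (M i) ^ 5 ≤ 1 / (2 * (3 * (K i : ℝ) ^ 2 + 2 * (K i : ℝ) ^ 4)))
    (hfar : ∀ i (b : PBond (F.P Kt) 0), b.src ∉ maxDomT ν.M₁ (Z i) 1 →
      (⟨blockIter (k i) b.src, b.dir⟩ : PBond (F.P Kt) (k i)) ∉ bondsOf (pts (k i) (Λ i)))
    (hZblk : ∀ i, IsBlockUnion (k i) (Z i))
    (hM2 : 2 ≤ ν.M₁) (hdiv : ∀ i, side (F.P Kt).L ν.M₁ (k i) ∣ (F.P Kt).sitesPerDir 0)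
    {cE B₃ a₀ a₁' cA : ℝ} (hcE0 : 0 ≤ cE) (hcE : ∀ i, 12 * ((F.P Kt).d : ℝ) * ((n i : ℝ) + 2) ^ 2 ≤ cE) (hB₃ : 0 ≤ B₃)
    (heRa : ∀ i, (cE + 1) * eR i ≤ a₁' ∧ B₃ * ((cE + 1) * eR i) ≤ ν.εreg) (ha₀ : ν.εreg ≤ a₀)
    (hcA : 1 / 2 * (B₃ * (cE + 1) * (F.P Kt).eta 1 ^ 2) ^ 2 * (Fintype.card (Plaq (F.P Kt) 0) : ℝ) ≤ cA)
    (h15T : ∀ (k' : ℕ), k' ≤ (F.P Kt).m + (F.P Kt).K → side (F.P Kt).L ν.M₁ k' ∣ (F.P Kt).sitesPerDir 0 →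
      ∀ (s : B14.Eq218Concrete.Seq (fun n : ℕ => Node00.unionsOfCubes (F.P Kt) (side (F.P Kt).L ν.M₁ n)) k'),
      Node00.Sect2.SeqSeparated ν.M₁ s → 0 < ν.M₁ →
      ∀ (ε₀ : ℝ) (δ : ℕ → ℝ), (∀ j, j ≤ k' → 0 < δ j ∧ δ j ≤ a₁' ∧ B₃ * δ j ≤ ε₀) → (∀ j, j < k' → δ j ≤ 2 * δ (j + 1)) →
      (∀ j, j < k' → δ (j + 1) ≤ 2 * δ j) → ε₀ ≤ a₀ →
      ∀ W : MSField (F.P Kt) SU2,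
        Node00.Sect2.DataSmall7PTop (Node00.avOfRecord F 2 Kt) s.Ω (Node00.suppDomOfRecord F ν Kt s.Ω) k' δ W →
        ∀ U₀ : GaugeField (F.P Kt) 0 SU2, IsMinimizer (Node00.avOfRecord F 2 Kt)
            {U | (∀ j, j ≤ k' → PlaqSmallOn (Node00.Sect2.omegaPlaqsTop s.Ω (Node00.suppDomOfRecord F ν Kt s.Ω) j)
                (ε₀ * (F.P Kt).eta j ^ 2) U) ∧
              Node00.Sect2.CoDivClassOnTop s.Ω (Node00.suppDomOfRecord F ν Kt s.Ω) k' ε₀ U}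
            (genSet s.Ω k') W U₀ →
          (∀ j, j ≤ k' → PlaqSmallOn (Node00.Sect2.omegaPlaqsTop s.Ω (Node00.suppDomOfRecord F ν Kt s.Ω) j)
              (B₃ * δ j * (F.P Kt).eta j ^ 2) U₀) ∧
            ∀ j, j ≤ k' → Node00.Sect2.CoDivSmallOn (Node00.Sect2.omegaBondsTop s.Ω (Node00.suppDomOfRecord F ν Kt s.Ω) j)
              (B₃ * δ j * (F.P Kt).eta j ^ 3) U₀)
    (hcJ' : ∀ i, 2 * cA * eR i / R i + 4 * ((Fintype.card (Plaq (F.P Kt) 0) : ℝ) * (1 + 8 * 𝓐₀ i ^ 4)) / (R i * eR i) ≤ cJ)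
    : ∃ a₁ : ι → ℝ, (∀ i, 0 < a₁ i) ∧
      B15.Prop1Printed (lfVarOn su2Chart fun i =>
        InstOn.std (Node00.bgMSCoPOfRecord F 2 ν Kt (k i) (maxDomT ν.M₁ (Z i))) ν.M₁ (Z i) (Λ i) (k i) (M i) (a₁ i)
          (anExt (pts (k i) (Λ i)) (T i)
            (fun177std (Node00.bgMSCoPOfRecord F 2 ν Kt (k i) (maxDomT ν.M₁ (Z i))) ν.M₁ (Z i) (k i)) (ext i)
            (min (1 / 2) (min (R i / 8) (γ / (M i) ^ 5 * (R i / 2) ^ 2 /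
              (48 * (4 * ((Fintype.card (Plaq (F.P Kt) 0) : ℝ) * (1 + 8 * 𝓐₀ i ^ 4)) / R i + 1)))))))
    := by
  have hρn0 : ∀ i, 0 ≤ ρn i := fun i => le_trans (by have := heR i; positivity) (hρn i)
  have hT0 : ∀ i, 0 ≤ max (ρn i) ((((2 * (∑ l ∈ Finset.range (k i + 1), ((F.P Kt).d * (((F.P Kt).L ^ l - 1) / 2) + 1)) + 1 + (3 * ((F.P Kt).d * (((F.P Kt).L - 1) / 2)) + 5) * (F.P Kt).L ^ (k i) : ℕ) : ℝ)) ^ 2 / 4 * (ν.εreg * (F.P Kt).eta 0 ^ 2) + ((3 * ((F.P Kt).d * (((F.P Kt).L - 1) / 2)) + 5 : ℕ) : ℝ) * (6 * ((((((F.P Kt).d + 2) * (F.P Kt).L : ℕ) : ℝ) ^ 2 / 4) * (2 * (ν.εreg * (F.P Kt).L ^ 2))) * ∑ l ∈ Finset.range (k i), ((F.P Kt).L : ℝ) ^ l) + ((3 * ((F.P Kt).d * (((F.P Kt).L - 1) / 2)) + 5 : ℕ) : ℝ) * ρn i) := fun i => (hρn0 i).trans (le_max_left _ _)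
  -- the pinned tolerance is positive: its second branch contains `C₁·εreg·η₀² > 0`
  have hTpos : ∀ i, 0 < max (ρn i) ((((2 * (∑ l ∈ Finset.range (k i + 1), ((F.P Kt).d * (((F.P Kt).L ^ l - 1) / 2) + 1)) + 1 + (3 * ((F.P Kt).d * (((F.P Kt).L - 1) / 2)) + 5) * (F.P Kt).L ^ (k i) : ℕ) : ℝ)) ^ 2 / 4 * (ν.εreg * (F.P Kt).eta 0 ^ 2) + ((3 * ((F.P Kt).d * (((F.P Kt).L - 1) / 2)) + 5 : ℕ) : ℝ) * (6 * ((((((F.P Kt).d + 2) * (F.P Kt).L : ℕ) : ℝ) ^ 2 / 4) * (2 * (ν.εreg * (F.P Kt).L ^ 2))) * ∑ l ∈ Finset.range (k i), ((F.P Kt).L : ℝ) ^ l) + ((3 * ((F.P Kt).d * (((F.P Kt).L - 1) / 2)) + 5 : ℕ) : ℝ) * ρn i) := fun i => by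
    have hη : (0 : ℝ) < (F.P Kt).eta 0 := by rw [show (F.P Kt).eta 0 = 1 from pow_zero _]; exact one_pos
    have h1 : (0 : ℝ) < (((2 * (∑ l ∈ Finset.range (k i + 1), ((F.P Kt).d * (((F.P Kt).L ^ l - 1) / 2) + 1)) + 1 + (3 * ((F.P Kt).d * (((F.P Kt).L - 1) / 2)) + 5) * (F.P Kt).L ^ (k i) : ℕ) : ℝ)) ^ 2 / 4 * (ν.εreg * (F.P Kt).eta 0 ^ 2) := by positivity
    have h2 : (0 : ℝ) ≤ ((3 * ((F.P Kt).d * (((F.P Kt).L - 1) / 2)) + 5 : ℕ) : ℝ) * (6 * ((((((F.P Kt).d + 2) * (F.P Kt).L : ℕ) : ℝ) ^ 2 / 4) * (2 * (ν.εreg * (F.P Kt).L ^ 2))) * ∑ l ∈ Finset.range (k i), ((F.P Kt).L : ℝ) ^ l) := by have := hεpos.le; positivity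
    have h3 : (0 : ℝ) ≤ ((3 * ((F.P Kt).d * (((F.P Kt).L - 1) / 2)) + 5 : ℕ) : ℝ) * ρn i := mul_nonneg (Nat.cast_nonneg _) (hρn0 i)
    exact lt_max_of_lt_right (by linarith)
  refine N12Prop1OfGaugeLetterAndChartConstantsLoc.exists_domain_prop1Printed_lfVarOn_std_su2_box_intrinsic_analytic_atZSeqCoPRecord_ofThm1TorusClass_ofMinimiserFamily_ofGaugeLetterN_ofChartConstantsN_ofCoercive
    ν Kt hd3 h0 Z Λ k M hk0 hk eR heR T lo hi n hn hN hbox hZ hTG0 hN5 K hK1 hKn ext hext hlohi LO HI hLO hHI n' hn' hn'N hR' ρn hρn hγ hcJ hbx hbxM hM hR hMin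
    (δc := fun i => max (ρn i) ((((2 * (∑ l ∈ Finset.range (k i + 1), ((F.P Kt).d * (((F.P Kt).L ^ l - 1) / 2) + 1)) + 1 + (3 * ((F.P Kt).d * (((F.P Kt).L - 1) / 2)) + 5) * (F.P Kt).L ^ (k i) : ℕ) : ℝ)) ^ 2 / 4 * (ν.εreg * (F.P Kt).eta 0 ^ 2) + ((3 * ((F.P Kt).d * (((F.P Kt).L - 1) / 2)) + 5 : ℕ) : ℝ) * (6 * ((((((F.P Kt).d + 2) * (F.P Kt).L : ℕ) : ℝ) ^ 2 / 4) * (2 * (ν.εreg * (F.P Kt).L ^ 2))) * ∑ l ∈ Finset.range (k i), ((F.P Kt).L : ℝ) ^ l) + ((3 * ((F.P Kt).d * (((F.P Kt).L - 1) / 2)) + 5 : ℕ) : ℝ) * ρn i)) (δin := fun i => max (ρn i) ((((2 * (∑ l ∈ Finset.range (k i + 1), ((F.P Kt).d * (((F.P Kt).L ^ l - 1) / 2) + 1)) + 1 + (3 * ((F.P Kt).d * (((F.P Kt).L - 1) / 2)) + 5) * (F.P Kt).L ^ (k i) : ℕ) : ℝ)) ^ 2 / 4 * (ν.εreg * (F.P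 Kt).eta 0 ^ 2) + ((3 * ((F.P Kt).d * (((F.P Kt).L - 1) / 2)) + 5 : ℕ) : ℝ) * (6 * ((((((F.P Kt).d + 2) * (F.P Kt).L : ℕ) : ℝ) ^ 2 / 4) * (2 * (ν.εreg * (F.P Kt).L ^ 2))) * ∑ l ∈ Finset.range (k i), ((F.P Kt).L : ℝ) ^ l) + ((3 * ((F.P Kt).d * (((F.P Kt).L - 1) / 2)) + 5 : ℕ) : ℝ) * ρn i)) hT0 hT0 ρs Cμ Cρ C₂ Cτ hCμ hCρ hC₂
    (fun i => ⟨by rw [max_self]; exact hTpos i, by rw [max_self]; exact hsmallT i⟩) h𝓐₀ N ?_ hchartN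
    (fun i => by simpa only [max_self] using hsmT i) hγle hfar hZblk hM2 hdiv hcE0 hcE hB₃ heRa ha₀ hcA h15T hcJ'
  -- (σ)_N at the pinned tolerance: dag-n12-w3's explicit producer, one call per base field and minimiser
  intro i Vk _hV hnV U₀ hU₀
  exact N12GaugeLetterLocExplicitLocal.exists_gaugeLetterLoc_atRecord_explicit_local ν Kt (hk0 i) (hk i) (hdiv i) (Z i) (hkc i) (hc i) hMrad (hρn0 i)
    (ext i Vk) (boxBonds (LO i) (HI i) : Set (PBond (F.P Kt) (k i))) hnV hU₀ (N i) (hGN i) (hN1 i) hεpos hα3 hα2 haN hM₁ (hGmem i)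

end Summit.QuantumFields.YangMills.BalabanUVNodes.N12Prop1OfGaugeLetterExplicitLocLocal

end
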